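import Literature.NumberTheory.Sieve.FGKMT2018DkBoxClasses
import Literature.NumberTheory.Sieve.FGKMT2018ResidueClassCount
import Literature.NumberTheory.Sieve.Maynard2016Lemma85LamBound
import Literature.NumberTheory.Sieve.AsymptoticSieveForPrimesReduction
import HarnessLib

/-!
# Maynard 2016, Proposition 9.2 over `𝒜 = ℤ`: tools for the error term

Source: J. Maynard, *Dense clusters of primes in subsets*, Compositio Math. 152 (2016) =
arXiv:1405.2593 [Maynard2016DenseClusters], proof of Proposition 9.2 p. 21 («The contribution from
$E(q,a)$ can be bounded by (2) in an identical manner to how we bounded the error terms in the proof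
of Proposition 9.1 by Hypothesis 1 … $O(\#\mathcal{A}(x)/(W(\log x)^{2k^2}))$»), and the pattern of
the proof of Proposition 9.1 p. 19 («there are $O(\tau_{3k}(q))$ ways of writing $q = W[\mathbf d,
\mathbf e]$ … Cauchy–Schwarz … the average of $E_q$ for the second sum»); K. Ford, B. Green,
S. Konyagin, J. Maynard, T. Tao, *Long gaps between primes*, JAMS 31 (2018) = arXiv:1412.5029v4
[FordGreenKonyaginMaynardTao2018], Definition 2 (Hypothesis 1 (2)) p. 20.

PROVED here (no named facts), frame-free ingredients for the error part
`Literature.NumberTheory.Sieve.Maynard2016Prop92ErrorPart` of Prop. 9.2: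
* the class errors `classErr L X q c = |#𝒫_L(X; q, c) − #𝒫_L(X)/φ_L(q)|`, a maximising class
  choice (`exists_classMax`) and `errStar` = the summand of Hypothesis 1 (2) at that choice, with
  `classErr_le_errStar`, the Hypothesis-1 average bound `sum_errStar_le_of_hypothesisOneZ` and the
  trivial bound `classErr_le_three_mul_div_totient` (`≤ 3#𝒜(X)/φ(q)`);
* the **fibre bound** `card_fibre_prodLcm_le`: the number of cross-coprime pairs `(d, e)` of vectors
  with squarefree products and `∏ᵢ [dᵢ, eᵢ] = q` is `≤ (4(k+1))^{ω(q)}` (a prime `p ∣ q` is coded by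
  the index `i` with `p ∣ dᵢeᵢ` and by whether `p ∣ d`, `p ∣ e`);
* the **Cauchy–Schwarz over fibres** `sum_comp_le_sqrt_mul_sqrt`:
  `∑_{p ∈ T} h(Q p) ≤ (∑_{q} τ(q)² h(q))^{1/2} (∑_{q} h(q))^{1/2}`, `τ(q) = #{p ∈ T : Q p = q}`;
* the divisor-sum bound `sum_natPow_omega_div_totient_le`:
  `∑_{q ≤ N squarefree} c^{ω(q)}/φ(q) ≤ ∏_{p ≤ N} (1 + c/(p−1)) ≤ (e⁵ log N)^c` (`c ∈ ℕ`, Mertens via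
  `prod_primesLE_inv_pow_le`).

## References
* J. Maynard, *Dense clusters of primes in subsets*, Compositio Math. 152 (2016), proofs of
  Props. 9.1, 9.2 pp. 19–21 [Maynard2016DenseClusters].
* K. Ford, B. Green, S. Konyagin, J. Maynard, T. Tao, *Long gaps between primes*, JAMS 31 (2018),
  §7 [FordGreenKonyaginMaynardTao2018].
-/

noncomputable section

open Finset Filter

namespace Literature.NumberTheory.Sieve.FGKMT2018

variable {k : ℕ}

/-! ### Class errors, the maximising class, and Hypothesis 1 (2) -/

/-- `E_L(X; q, c) = |#𝒫_L(X; q, c) − #𝒫_L(X)/φ_L(q)|`.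
[cite: Maynard2016DenseClusters, proof of Prop. 9.2 p. 21 («E(q,a)»)] -/
def classErr (l : ℤ × ℤ) (X : ℝ) (q : ℕ) (c : ℤ) : ℝ :=
  |(primeCountZMod l X q c : ℝ) - primeCountZ l X / totForm l q|

/-- `E_L(X; q, c) ≥ 0`. [cite: Maynard2016DenseClusters, proof of Prop. 9.2 p. 21 («E(q,a)»)] -/
theorem classErr_nonneg (l : ℤ × ℤ) (X : ℝ) (q : ℕ) (c : ℤ) : 0 ≤ classErr l X q c := abs_nonneg _

/-- A class choice `a(q)` maximising `E_L(X; q, ·)` over the classes `c (mod q)` with `(L(c), q) = 1`.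
[cite: Maynard2016DenseClusters, Hypothesis 1 (2) p. 4 («max_{(L(a),q)=1}»); FordGreenKonyaginMaynardTao2018, Definition 2 p. 20] -/
theorem exists_classMax (l : ℤ × ℤ) (X : ℝ) :
    ∃ a : ℕ → ℕ, ∀ q c : ℕ, c < q → Int.gcd (formEval l c) q = 1 →
      Int.gcd (formEval l (a q)) q = 1 ∧ classErr l X q c ≤ classErr l X q (a q) := by
  classical
  have key : ∀ q : ℕ, ∃ a : ℕ, ∀ c : ℕ, c < q → Int.gcd (formEval l c) q = 1 →
      Int.gcd (formEval l a) q = 1 ∧ classErr l X q c ≤ classErr l X q a := by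
    intro q
    by_cases h : ((Finset.range q).filter fun c : ℕ => Int.gcd (formEval l c) q = 1).Nonempty
    · obtain ⟨a, ha, hmax⟩ := Finset.exists_max_image _ (fun c : ℕ => classErr l X q c) h
      exact ⟨a, fun c hc hg => ⟨(Finset.mem_filter.1 ha).2,
        hmax c (Finset.mem_filter.2 ⟨Finset.mem_range.2 hc, hg⟩)⟩⟩
    · exact ⟨0, fun c hc hg => (h ⟨c, Finset.mem_filter.2 ⟨Finset.mem_range.2 hc, hg⟩⟩).elim⟩
  choose a ha using key
  exact ⟨a, ha⟩

/-- `E*_q` for a class choice `a`: literally the summand of Hypothesis 1 (2) at `a`.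
[cite: FordGreenKonyaginMaynardTao2018, Definition 2 (Hypothesis 1 (2)) p. 20] -/
def errStar (l : ℤ × ℤ) (X : ℝ) (a : ℕ → ℕ) (q : ℕ) : ℝ :=
  if Int.gcd (formEval l (a q)) q = 1 then
    |(primeCountZMod l X q (a q) : ℝ) - primeCountZ l X / totForm l q| else 0

/-- `E*_q ≥ 0`. [cite: FordGreenKonyaginMaynardTao2018, Definition 2 (Hypothesis 1 (2)) p. 20] -/
theorem errStar_nonneg (l : ℤ × ℤ) (X : ℝ) (a : ℕ → ℕ) (q : ℕ) : 0 ≤ errStar l X a q := by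
  unfold errStar
  split_ifs
  · exact abs_nonneg _
  · exact le_rfl

/-- At a maximising choice, every admissible class error is `≤ E*_q`.
[cite: Maynard2016DenseClusters, proof of Prop. 9.2 p. 21 («bounded by (2)»)] -/
theorem classErr_le_errStar {l : ℤ × ℤ} {X : ℝ} {a : ℕ → ℕ}
    (ha : ∀ q c : ℕ, c < q → Int.gcd (formEval l c) q = 1 →
      Int.gcd (formEval l (a q)) q = 1 ∧ classErr l X q c ≤ classErr l X q (a q))
    {q c : ℕ} (hc : c < q) (hg : Int.gcd (formEval l c) q = 1) :
    classErr l X q c ≤ errStar l X a q := by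
  obtain ⟨h1, h2⟩ := ha q c hc hg
  unfold errStar
  rw [if_pos h1]
  exact h2

/-- **Hypothesis 1 (2)** bounds `∑_{q ≤ X^θ, (q,B)=1} E*_q`.
[cite: FordGreenKonyaginMaynardTao2018, Definition 2 (Hypothesis 1 (2)) p. 20] -/
theorem sum_errStar_le_of_hypothesisOneZ {θ : ℝ} {B : ℕ} {X : ℝ} {l : ℤ × ℤ} {C : ℝ}
    (h : HypothesisOneZ θ B k X l C) (a : ℕ → ℕ) :
    ∑ q ∈ (Finset.Icc 1 ⌊X ^ θ⌋₊).filter (fun q => Nat.Coprime q B), errStar l X a q ≤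
      C * primeCountZ l X / Real.log X ^ (100 * k ^ 2) :=
  h fun q => (a q : ℤ)

/-- `φ_L(q) ≥ φ(q)` (`φ(|a|q) ≥ φ(|a|)φ(q)`). [cite: FordGreenKonyaginMaynardTao2018, §7 p. 20 (φ_L)] -/
theorem totient_le_totForm (l : ℤ × ℤ) (hl : l.1 ≠ 0) (q : ℕ) :
    (Nat.totient q : ℝ) ≤ totForm l q := by
  unfold totForm
  have ha : 0 < Nat.totient l.1.natAbs := Nat.totient_pos.2 (Int.natAbs_pos.2 hl)
  rw [le_div_iff₀ (by exact_mod_cast ha), mul_comm]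
  exact_mod_cast Nat.totient_super_multiplicative _ _

/-- The trivial bound `E_L(X; q, c) ≤ 3#𝒜(X)/φ(q)` for `1 ≤ q ≤ #𝒜(X)`
(`#𝒫_L(X;q,c) ≤ #𝒜(X;q,c) ≤ #𝒜(X)/q + 1`, `#𝒫_L(X)/φ_L(q) ≤ #𝒜(X)/φ(q)`).
[cite: Maynard2016DenseClusters, proof of Prop. 9.1 p. 19 («E_q ≪ #𝒜(x)/q for the first sum»)] -/
theorem classErr_le_three_mul_div_totient (l : ℤ × ℤ) (hl : l.1 ≠ 0) (X : ℝ) {q : ℕ} (hq : 0 < q)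
    (hqA : (q : ℝ) ≤ #(dyadZ X)) (c : ℤ) :
    classErr l X q c ≤ 3 * (#(dyadZ X) : ℝ) / Nat.totient q := by
  classical
  have hφpos : (0 : ℝ) < Nat.totient q := by exact_mod_cast Nat.totient_pos.2 hq
  have hφq : (Nat.totient q : ℝ) ≤ q := by exact_mod_cast Nat.totient_le q
  have hA0 : (0 : ℝ) ≤ #(dyadZ X) := Nat.cast_nonneg _
  have h1 : (primeCountZMod l X q c : ℝ) ≤ (#(dyadZ X) : ℝ) / q + 1 := by
    refine le_trans ?_ (card_dyadZ_modEq_le_div_add_one X hq c)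
    unfold primeCountZMod
    exact_mod_cast Finset.card_le_card (fun n hn => by
      rw [Finset.mem_filter] at hn ⊢; exact ⟨hn.1, hn.2.1⟩)
  have h2 : (primeCountZ l X : ℝ) / totForm l q ≤ (#(dyadZ X) : ℝ) / Nat.totient q := by
    have hP : (primeCountZ l X : ℝ) ≤ #(dyadZ X) := by
      unfold primeCountZ; exact_mod_cast Finset.card_le_card (Finset.filter_subset _ _)
    have ht := totient_le_totForm l hl q
    calc (primeCountZ l X : ℝ) / totForm l q ≤ (#(dyadZ X) : ℝ) / totForm l q :=
          div_le_div_of_nonneg_right hP (hφpos.le.trans ht)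
      _ ≤ (#(dyadZ X) : ℝ) / Nat.totient q := div_le_div_of_nonneg_left hA0 hφpos ht
  have h3 : (#(dyadZ X) : ℝ) / q ≤ (#(dyadZ X) : ℝ) / Nat.totient q :=
    div_le_div_of_nonneg_left hA0 hφpos hφq
  have h4 : (1 : ℝ) ≤ (#(dyadZ X) : ℝ) / Nat.totient q := by
    rw [le_div_iff₀ hφpos, one_mul]; exact hφq.trans hqA
  have hP0 : (0 : ℝ) ≤ primeCountZMod l X q c := Nat.cast_nonneg _
  have hQ0 : (0 : ℝ) ≤ (primeCountZ l X : ℝ) / totForm l q :=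
    div_nonneg (Nat.cast_nonneg _) (hφpos.le.trans (totient_le_totForm l hl q))
  unfold classErr
  rw [abs_le]
  constructor
  · have : 3 * (#(dyadZ X) : ℝ) / Nat.totient q = 3 * ((#(dyadZ X) : ℝ) / Nat.totient q) := by ring
    rw [this]; linarith
  · have : 3 * (#(dyadZ X) : ℝ) / Nat.totient q = 3 * ((#(dyadZ X) : ℝ) / Nat.totient q) := by ring
    rw [this]; linarith

/-- The same bound for `E*_q`. [cite: Maynard2016DenseClusters, proof of Prop. 9.1 p. 19 («E_q ≪ #𝒜(x)/q»)] -/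
theorem errStar_le_three_mul_div_totient (l : ℤ × ℤ) (hl : l.1 ≠ 0) (X : ℝ) (a : ℕ → ℕ) {q : ℕ}
    (hq : 0 < q) (hqA : (q : ℝ) ≤ #(dyadZ X)) :
    errStar l X a q ≤ 3 * (#(dyadZ X) : ℝ) / Nat.totient q := by
  unfold errStar
  split_ifs
  · exact classErr_le_three_mul_div_totient l hl X hq hqA _
  · exact div_nonneg (mul_nonneg (by norm_num) (Nat.cast_nonneg _)) (Nat.cast_nonneg _)

/-! ### Squarefree bookkeeping -/

/-- The `lcm` of two squarefree numbers is squarefree. [folklore] -/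
private theorem squarefree_lcm_of_squarefree {a b : ℕ} (ha : Squarefree a) (hb : Squarefree b) :
    Squarefree (Nat.lcm a b) := by
  have ha0 : a ≠ 0 := ha.ne_zero
  have hb0 : b ≠ 0 := hb.ne_zero
  have hl0 : Nat.lcm a b ≠ 0 := (Nat.lcm_pos (Nat.pos_of_ne_zero ha0) (Nat.pos_of_ne_zero hb0)).ne'
  rw [Nat.squarefree_iff_factorization_le_one hl0]
  intro p
  rw [Nat.factorization_lcm ha0 hb0, Finsupp.sup_apply]
  exact sup_le ((Nat.squarefree_iff_factorization_le_one ha0).mp ha p)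
    ((Nat.squarefree_iff_factorization_le_one hb0).mp hb p)

/-- A product of pairwise coprime squarefree numbers is squarefree. [folklore] -/
private theorem squarefree_prod_of_coprime (f : Fin k → ℕ) (hsq : ∀ i, Squarefree (f i))
    (hcop : ∀ i j, i ≠ j → (f i).Coprime (f j)) : Squarefree (∏ i, f i) := by
  classical
  have key : ∀ s : Finset (Fin k), Squarefree (∏ i ∈ s, f i) := by
    intro s
    induction s using Finset.induction_on with
    | empty => simp
    | @insert a s has ih =>
      rw [Finset.prod_insert has]
      have hc : (f a).Coprime (∏ i ∈ s, f i) :=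
        Nat.Coprime.prod_right fun i hi => hcop a i (fun h => has (h ▸ hi))
      exact (Nat.squarefree_mul hc).2 ⟨hsq a, ih⟩
  exact key Finset.univ

/-- For a cross-coprime pair with squarefree products, `∏ᵢ [dᵢ, eᵢ]` is squarefree.
[cite: Maynard2016DenseClusters, proof of Prop. 9.1 p. 19 («all such q are square-free»)] -/
theorem squarefree_prodLcm {d e : Fin k → ℕ} (hd : Squarefree (∏ i, d i)) (he : Squarefree (∏ i, e i))
    (hx : ∀ i j, i ≠ j → (d i * e i).Coprime (d j * e j)) :
    Squarefree (∏ i, Nat.lcm (d i) (e i)) := by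
  refine squarefree_prod_of_coprime _ (fun i => squarefree_lcm_of_squarefree
    (hd.squarefree_of_dvd (Finset.dvd_prod_of_mem _ (Finset.mem_univ i)))
    (he.squarefree_of_dvd (Finset.dvd_prod_of_mem _ (Finset.mem_univ i)))) fun i j hij => ?_
  exact Nat.Coprime.coprime_dvd_left (Nat.lcm_dvd_mul _ _)
    (Nat.Coprime.coprime_dvd_right (Nat.lcm_dvd_mul _ _) (hx i j hij))

/-- `φ(q) = ∏_{p ∣ q} (p − 1)` for squarefree `q`. [folklore] -/
private theorem cast_totient_of_squarefree {q : ℕ} (hq : Squarefree q) :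
    (Nat.totient q : ℝ) = ∏ p ∈ q.primeFactors, ((p : ℝ) - 1) := by
  have hn : q ≠ 0 := hq.ne_zero
  rw [Nat.totient_eq_prod_factorization hn]
  push_cast
  rw [Finsupp.prod, Nat.support_factorization]
  refine Finset.prod_congr rfl fun p hp => ?_
  have hpp := Nat.prime_of_mem_primeFactors hp
  have h1 : q.factorization p = 1 := by
    have := (Nat.squarefree_iff_factorization_le_one hn).1 hq p
    have hpos : 0 < q.factorization p :=
      Nat.Prime.factorization_pos_of_dvd hpp hn (Nat.dvd_of_mem_primeFactors hp)
    omega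
  rw [h1, Nat.cast_sub hpp.one_lt.le]
  simp

/-- Two squarefree divisors of `q ≠ 0` with the same prime divisors among the primes of `q` are equal.
[folklore] -/
private theorem eq_of_squarefree_of_dvd_iff {a b q : ℕ} (ha : Squarefree a) (hb : Squarefree b) (haq : a ∣ q)
    (hbq : b ∣ q) (hq : q ≠ 0) (h : ∀ p ∈ q.primeFactors, p ∣ a ↔ p ∣ b) : a = b := by
  have hpf : a.primeFactors = b.primeFactors := by
    ext p
    simp only [Nat.mem_primeFactors]
    constructor
    · rintro ⟨hp, hpa, -⟩
      exact ⟨hp, (h p (Nat.mem_primeFactors.2 ⟨hp, hpa.trans haq, hq⟩)).1 hpa, hb.ne_zero⟩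
    · rintro ⟨hp, hpb, -⟩
      exact ⟨hp, (h p (Nat.mem_primeFactors.2 ⟨hp, hpb.trans hbq, hq⟩)).2 hpb, ha.ne_zero⟩
  rw [← Nat.prod_primeFactors_of_squarefree ha, ← Nat.prod_primeFactors_of_squarefree hb, hpf]

/-! ### The fibre bound `#{(d, e) : ∏ᵢ [dᵢ, eᵢ] = q} ≤ (4(k+1))^{ω(q)}` -/

/-- The index `i` with `p ∣ dᵢ eᵢ` (if any). [folklore] -/
private def pfIdx (d e : Fin k → ℕ) (p : ℕ) : Option (Fin k) :=
  if h : ∃ i, p ∣ d i * e i then some h.choose else none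

/-- The code of a prime w.r.t. a pair: its index and whether it divides `∏ dᵢ`, `∏ eᵢ`. [folklore] -/
private def pfCode (d e : Fin k → ℕ) (p : ℕ) : Option (Fin k) × Bool × Bool :=
  (pfIdx d e p, decide (p ∣ ∏ i, d i), decide (p ∣ ∏ i, e i))

/-- Uniqueness of the index for cross-coprime pairs. [folklore] -/
private theorem pfIdx_eq_some {d e : Fin k → ℕ} (hx : ∀ i j, i ≠ j → (d i * e i).Coprime (d j * e j))
    {p : ℕ} (hp : p.Prime) {i : Fin k} (hi : p ∣ d i * e i) : pfIdx d e p = some i := by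
  classical
  have h : ∃ i, p ∣ d i * e i := ⟨i, hi⟩
  unfold pfIdx
  rw [dif_pos h]
  congr 1
  by_contra hne
  have h1 : Nat.Coprime p p :=
    Nat.Coprime.coprime_dvd_right hi (Nat.Coprime.coprime_dvd_left h.choose_spec (hx _ _ hne))
  have h2 : p = 1 := by
    have := h1
    unfold Nat.Coprime at this
    rwa [Nat.gcd_self] at this
  exact hp.one_lt.ne' h2

/-- `p ∣ dᵢ` is read off the code. [folklore] -/
private theorem dvd_left_iff_pfCode {d e : Fin k → ℕ} (hx : ∀ i j, i ≠ j → (d i * e i).Coprime (d j * e j))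
    {p : ℕ} (hp : p.Prime) (i : Fin k) :
    p ∣ d i ↔ (p ∣ ∏ j, d j) ∧ pfIdx d e p = some i := by
  constructor
  · intro h
    exact ⟨h.trans (Finset.dvd_prod_of_mem _ (Finset.mem_univ i)),
      pfIdx_eq_some hx hp (h.mul_right _)⟩
  · rintro ⟨hprod, hidx⟩
    obtain ⟨j, -, hj⟩ := hp.prime.exists_mem_finset_dvd hprod
    have h2 := pfIdx_eq_some hx hp (Dvd.dvd.mul_right hj (e j))
    rw [hidx] at h2
    cases h2
    exact hj

/-- `p ∣ eᵢ` is read off the code. [folklore] -/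
private theorem dvd_right_iff_pfCode {d e : Fin k → ℕ} (hx : ∀ i j, i ≠ j → (d i * e i).Coprime (d j * e j))
    {p : ℕ} (hp : p.Prime) (i : Fin k) :
    p ∣ e i ↔ (p ∣ ∏ j, e j) ∧ pfIdx d e p = some i := by
  constructor
  · intro h
    exact ⟨h.trans (Finset.dvd_prod_of_mem _ (Finset.mem_univ i)),
      pfIdx_eq_some hx hp (Dvd.dvd.mul_left h _)⟩
  · rintro ⟨hprod, hidx⟩
    obtain ⟨j, -, hj⟩ := hp.prime.exists_mem_finset_dvd hprod
    have h2 := pfIdx_eq_some hx hp (Dvd.dvd.mul_left hj (d j))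
    rw [hidx] at h2
    cases h2
    exact hj

/-- **The fibre bound** («there are `O(τ_{3k}(q))` ways of writing `q = W[d, e]`»): among
cross-coprime pairs `(d, e)` with squarefree `∏ dᵢ`, `∏ eᵢ`, at most `(4(k+1))^{ω(q)}` have
`∏ᵢ [dᵢ, eᵢ] = q`. [cite: Maynard2016DenseClusters, proof of Prop. 9.1 p. 19; proof of Prop. 9.2 p. 21 («identical manner»)] -/
theorem card_fibre_prodLcm_le (T : Finset ((Fin k → ℕ) × (Fin k → ℕ)))
    (hT : ∀ pr ∈ T, Squarefree (∏ i, pr.1 i) ∧ Squarefree (∏ i, pr.2 i) ∧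
      ∀ i j, i ≠ j → (pr.1 i * pr.2 i).Coprime (pr.1 j * pr.2 j))
    {q : ℕ} (hq : q ≠ 0) :
    #(T.filter fun pr => ∏ i, Nat.lcm (pr.1 i) (pr.2 i) = q) ≤ (4 * (k + 1)) ^ q.primeFactors.card := by
  classical
  set S := T.filter (fun pr => ∏ i, Nat.lcm (pr.1 i) (pr.2 i) = q) with hS
  let Φ : ((Fin k → ℕ) × (Fin k → ℕ)) → (q.primeFactors → Option (Fin k) × Bool × Bool) :=
    fun pr x => pfCode pr.1 pr.2 x.1
  have hinj : Set.InjOn Φ S := by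
    rintro ⟨d, e⟩ hde ⟨d', e'⟩ hde' hΦ
    obtain ⟨hdeT, hq1⟩ := Finset.mem_filter.1 (Finset.mem_coe.1 hde)
    obtain ⟨hdeT', hq2⟩ := Finset.mem_filter.1 (Finset.mem_coe.1 hde')
    obtain ⟨hsd, hse, hx⟩ := hT _ hdeT
    obtain ⟨hsd', hse', hx'⟩ := hT _ hdeT'
    have hcode : ∀ p ∈ q.primeFactors, pfCode d e p = pfCode d' e' p :=
      fun p hp => congr_fun hΦ ⟨p, hp⟩
    have hc : ∀ p ∈ q.primeFactors, pfIdx d e p = pfIdx d' e' p ∧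
        ((p ∣ ∏ i, d i) ↔ (p ∣ ∏ i, d' i)) ∧ ((p ∣ ∏ i, e i) ↔ (p ∣ ∏ i, e' i)) := by
      intro p hp
      have h0 := hcode p hp
      simp only [pfCode, Prod.mk.injEq, decide_eq_decide] at h0
      exact h0
    have hdvd1 : ∀ (f g : Fin k → ℕ), (∏ i, Nat.lcm (f i) (g i) = q) → ∀ i, f i ∣ q ∧ g i ∣ q :=
      fun f g hfg i => ⟨hfg ▸ (Nat.dvd_lcm_left (f i) (g i)).trans
        (Finset.dvd_prod_of_mem _ (Finset.mem_univ i)),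
        hfg ▸ (Nat.dvd_lcm_right (f i) (g i)).trans (Finset.dvd_prod_of_mem _ (Finset.mem_univ i))⟩
    have hsq : ∀ (f : Fin k → ℕ), Squarefree (∏ i, f i) → ∀ i, Squarefree (f i) :=
      fun f hf i => hf.squarefree_of_dvd (Finset.dvd_prod_of_mem _ (Finset.mem_univ i))
    have hd : d = d' := by
      funext i
      refine eq_of_squarefree_of_dvd_iff (hsq d hsd i) (hsq d' hsd' i) (hdvd1 d e hq1 i).1
        (hdvd1 d' e' hq2 i).1 hq fun p hp => ?_
      have hpp := Nat.prime_of_mem_primeFactors hp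
      rw [dvd_left_iff_pfCode hx hpp i, dvd_left_iff_pfCode hx' hpp i, (hc p hp).1, (hc p hp).2.1]
    have he : e = e' := by
      funext i
      refine eq_of_squarefree_of_dvd_iff (hsq e hse i) (hsq e' hse' i) (hdvd1 d e hq1 i).2
        (hdvd1 d' e' hq2 i).2 hq fun p hp => ?_
      have hpp := Nat.prime_of_mem_primeFactors hp
      rw [dvd_right_iff_pfCode hx hpp i, dvd_right_iff_pfCode hx' hpp i, (hc p hp).1, (hc p hp).2.2]
    rw [hd, he]
  calc #S ≤ #(Finset.univ : Finset (q.primeFactors → Option (Fin k) × Bool × Bool)) :=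
        Finset.card_le_card_of_injOn Φ (fun _ _ => Finset.mem_coe.2 (Finset.mem_univ _)) hinj
    _ = (4 * (k + 1)) ^ q.primeFactors.card := by
        rw [Finset.card_univ, Fintype.card_fun, Fintype.card_coe]
        simp only [Fintype.card_prod, Fintype.card_option, Fintype.card_fin, Fintype.card_bool]
        ring

/-! ### Cauchy–Schwarz over the fibres of `Q` -/

/-- `∑_{p ∈ T} h(Q p) = ∑_{q ∈ Q(T)} τ(q) h(q)`, `τ(q) = #{p ∈ T : Q p = q}`. [folklore] -/
private theorem sum_comp_eq_sum_image_card_mul {α : Type*} [DecidableEq α] (T : Finset α) (Q : α → ℕ)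
    (h : ℕ → ℝ) :
    ∑ p ∈ T, h (Q p) = ∑ q ∈ T.image Q, (#(T.filter fun p => Q p = q) : ℝ) * h q := by
  rw [← Finset.sum_fiberwise_of_maps_to (fun p hp => Finset.mem_image_of_mem Q hp)
    (f := fun p => h (Q p))]
  refine Finset.sum_congr rfl fun q _ => ?_
  rw [Finset.sum_congr rfl (fun p hp => by rw [(Finset.mem_filter.1 hp).2] :
    ∀ p ∈ T.filter (fun p => Q p = q), h (Q p) = h q), Finset.sum_const, nsmul_eq_mul]

/-- **Cauchy–Schwarz over fibres**: for `h ≥ 0`,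
`∑_{p ∈ T} h(Q p) ≤ (∑_{q ∈ Q(T)} τ(q)² h(q))^{1/2} (∑_{q ∈ Q(T)} h(q))^{1/2}`.
[cite: Maynard2016DenseClusters, proof of Prop. 9.1 p. 19 (the Cauchy–Schwarz display)] -/
theorem sum_comp_le_sqrt_mul_sqrt {α : Type*} [DecidableEq α] (T : Finset α) (Q : α → ℕ)
    {h : ℕ → ℝ} (h0 : ∀ q, 0 ≤ h q) :
    ∑ p ∈ T, h (Q p) ≤
      Real.sqrt (∑ q ∈ T.image Q, (#(T.filter fun p => Q p = q) : ℝ) ^ 2 * h q) *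
        Real.sqrt (∑ q ∈ T.image Q, h q) := by
  rw [sum_comp_eq_sum_image_card_mul]
  set I := T.image Q
  have hcs := Finset.sum_mul_sq_le_sq_mul_sq I
    (fun q => (#(T.filter fun p => Q p = q) : ℝ) * Real.sqrt (h q)) (fun q => Real.sqrt (h q))
  have e1 : ∀ q, (#(T.filter fun p => Q p = q) : ℝ) * Real.sqrt (h q) * Real.sqrt (h q) =
      (#(T.filter fun p => Q p = q) : ℝ) * h q := fun q => by
    rw [mul_assoc, Real.mul_self_sqrt (h0 q)]
  have e2 : ∀ q, ((#(T.filter fun p => Q p = q) : ℝ) * Real.sqrt (h q)) ^ 2 =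
      (#(T.filter fun p => Q p = q) : ℝ) ^ 2 * h q := fun q => by
    rw [mul_pow, Real.sq_sqrt (h0 q)]
  have e3 : ∀ q, Real.sqrt (h q) ^ 2 = h q := fun q => Real.sq_sqrt (h0 q)
  simp only [e1, e2, e3] at hcs
  have hA : 0 ≤ ∑ q ∈ I, (#(T.filter fun p => Q p = q) : ℝ) ^ 2 * h q :=
    Finset.sum_nonneg fun q _ => mul_nonneg (sq_nonneg _) (h0 q)
  rw [← Real.sqrt_mul hA]
  exact (le_abs_self _).trans (Real.abs_le_sqrt hcs)

/-! ### The divisor sum `∑_{q ≤ N squarefree} c^{ω(q)}/φ(q) ≤ (e⁵ log N)^c` -/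

/-- `∑_{q ∈ S} c^{ω(q)}/φ(q) ≤ ∏_{p ≤ N} (1 + c/(p−1))` for `S ⊆ {q ≤ N squarefree}`.
[cite: Maynard2016DenseClusters, proof of Prop. 9.1 p. 19 («∑_{q<R²W} μ²(q) τ_{3k}(q)²/q»)] -/
theorem sum_pow_card_primeFactors_div_totient_le (c : ℝ) (hc : 0 ≤ c) {S : Finset ℕ} {N : ℕ}
    (hS : ∀ q ∈ S, Squarefree q ∧ q ≤ N) :
    ∑ q ∈ S, c ^ q.primeFactors.card / (Nat.totient q : ℝ) ≤
      ∏ p ∈ Nat.primesLE N, (1 + c / ((p : ℝ) - 1)) := by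
  classical
  have hsub : S ⊆ (Finset.Icc 1 N).filter Squarefree := fun q hq =>
    Finset.mem_filter.2 ⟨Finset.mem_Icc.2 ⟨Nat.one_le_iff_ne_zero.2 (hS q hq).1.ne_zero, (hS q hq).2⟩,
      (hS q hq).1⟩
  have hterm : ∀ q ∈ (Finset.Icc 1 N).filter Squarefree,
      c ^ q.primeFactors.card / (Nat.totient q : ℝ) = ∏ p ∈ q.primeFactors, c / ((p : ℝ) - 1) := by
    intro q hq
    have hsq := (Finset.mem_filter.1 hq).2
    rw [cast_totient_of_squarefree hsq, Finset.prod_div_distrib, Finset.prod_const]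
  have hnn : ∀ q ∈ (Finset.Icc 1 N).filter Squarefree,
      0 ≤ c ^ q.primeFactors.card / (Nat.totient q : ℝ) := fun q _ =>
    div_nonneg (pow_nonneg hc _) (Nat.cast_nonneg _)
  calc ∑ q ∈ S, c ^ q.primeFactors.card / (Nat.totient q : ℝ)
      ≤ ∑ q ∈ (Finset.Icc 1 N).filter Squarefree, c ^ q.primeFactors.card / (Nat.totient q : ℝ) :=
        Finset.sum_le_sum_of_subset_of_nonneg hsub fun q hq _ => hnn q hq
    _ = ∑ q ∈ (Finset.Icc 1 N).filter Squarefree, ∏ p ∈ q.primeFactors, c / ((p : ℝ) - 1) :=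
        Finset.sum_congr rfl hterm
    _ ≤ ∏ p ∈ Nat.primesLE N, (1 + c / ((p : ℝ) - 1)) :=
        sum_squarefree_prod_primeFactors_le (f := fun p => c / ((p : ℝ) - 1)) (fun p hp =>
          div_nonneg hc (by
            have h2 : (2 : ℝ) ≤ p := by exact_mod_cast hp.two_le
            linarith)) N

/-- `∏_{p ≤ N} (1 + c/(p−1)) ≤ (e⁵ log N)^c` for `c ∈ ℕ`, `N ≥ 2`
(`1 + c x ≤ (1 + x)^c`, `1 + 1/(p−1) = (1 − 1/p)⁻¹`, Mertens).
[cite: Maynard2016DenseClusters, proof of Prop. 9.1 p. 19 («≪ … by Mertens»); Lemma 8.1 p. 15] -/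
theorem prod_primesLE_one_add_div_le (c : ℕ) {N : ℕ} (hN : 2 ≤ N) :
    ∏ p ∈ Nat.primesLE N, (1 + (c : ℝ) / ((p : ℝ) - 1)) ≤ (Real.exp 5 * Real.log N) ^ c := by
  refine le_trans ?_ (prod_primesLE_inv_pow_le (k := c) hN)
  refine Finset.prod_le_prod (fun p hp => ?_) fun p hp => ?_
  · have h2 : (2 : ℝ) ≤ p := by exact_mod_cast (Nat.prime_of_mem_primesLE hp).two_le
    have : (0 : ℝ) ≤ (c : ℝ) / ((p : ℝ) - 1) := div_nonneg (Nat.cast_nonneg _) (by linarith)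
    linarith
  · have h2 : (2 : ℝ) ≤ p := by exact_mod_cast (Nat.prime_of_mem_primesLE hp).two_le
    have hp0 : (0 : ℝ) < (p : ℝ) - 1 := by linarith
    have hinv : (1 - 1 / (p : ℝ))⁻¹ = 1 + 1 / ((p : ℝ) - 1) := by
      field_simp
      ring
    rw [hinv, div_eq_mul_one_div (c : ℝ)]
    have h3 : (-2 : ℝ) ≤ 1 / ((p : ℝ) - 1) := by
      have : (0 : ℝ) ≤ 1 / ((p : ℝ) - 1) := div_nonneg zero_le_one hp0.le
      linarith
    exact one_add_mul_le_pow h3 c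

/-- The combined divisor-sum bound: `∑_{q ∈ S} c^{ω(q)}/φ(q) ≤ (e⁵ log N)^c` for
`S ⊆ {q ≤ N squarefree}`, `c ∈ ℕ`, `N ≥ 2`. [cite: Maynard2016DenseClusters, proof of Prop. 9.1 p. 19] -/
theorem sum_natPow_omega_div_totient_le (c : ℕ) {S : Finset ℕ} {N : ℕ} (hN : 2 ≤ N)
    (hS : ∀ q ∈ S, Squarefree q ∧ q ≤ N) :
    ∑ q ∈ S, (c : ℝ) ^ q.primeFactors.card / (Nat.totient q : ℝ) ≤ (Real.exp 5 * Real.log N) ^ c :=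
  (sum_pow_card_primeFactors_div_totient_le (c : ℝ) (Nat.cast_nonneg _) hS).trans
    (prod_primesLE_one_add_div_le c hN)

end Literature.NumberTheory.Sieve.FGKMT2018
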